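import Mathlib
import HarnessLib
import Summits.NavierStokesRegularity.NavierStokesRegularity.Theorems.RellichScarNoMildScar

/-!
# Calm with bounded final trace on a cone is faint on every narrower cone (line calm-cone-carleman, crux
# ApexLocalisation stmt-NavierStokesRegularity-11719, stub `stub_faintOfCalmBoundedTrace` = S_B)

**Theorem (S_B).** Let `u` be a continuous suitable weak Navier–Stokes solution on the backward slab
`]-∞,0[ × ℝ³` with a weak spatial gradient, `𝐈 < ⊤` and the Type-I rate, which is apex-CALM on the cone
`Γ_κ(e) = {x | κ‖x‖ < ⟪x,e⟫}` (`‖u(t,x)‖ ≤ K/(‖x‖ + √(−t))` for `x ∈ Γ_κ(e)`, `t < 0`) and has a bounded final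
trace there near the origin (`‖u(t,x)‖ ≤ B` for `t ↑ 0`, each `x ∈ Γ_κ(e)` with `‖x‖ < δ₀`).  Then `u` is
scar-FAINT on every narrower cone `Γ_κ'(e)`, `κ < κ'`: for every `ε > 0` there are `δ, η > 0` with
`‖x‖‖u(t,x)‖ ≤ ε` for `x ∈ Γ_κ'(e)`, `‖x‖ < δ`, `−η‖x‖² < t < 0`.

Proof.  For `x ∈ Γ_κ'(e)` the ball `B(x, c‖x‖)`, `c = c(κ,κ') ∈ ]0, 1/2]`, lies in `Γ_κ(e)`, so calmness bounds
`c‖x‖ · |u| ≤ |K|` on the parabolic ball `Q((0,x), c‖x‖)`.  After the Navier–Stokes zoom by `r = c‖x‖` about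
`(0, x)` the data of Serrin's interior regularity theorem in the quantitative form
`NSBoundedHigherRegularityBounds_holds` are independent of `x` (radius `1`, sup bound `|K|`, and — in the
cylinder gauge `p − [p]_{B(x,r)}`, whose `L^{3/2}` norm is `≤ r²𝐈` — pressure bound `𝐈`), so the zoomed
velocity has a continuous representative with ONE Hölder modulus `(C₀, α₀)` on `Q(0, 1/2)`; by continuity it
is the zoomed velocity itself.  At the spatial centre this reads
`r‖u(t,x) − u(τ,x)‖ ≤ C₀ s₀^{α₀}` for `−s₀r² < t, τ < 0`, and choosing `τ` with `‖u(τ,x)‖ ≤ B` (the trace)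
gives `‖x‖‖u(t,x)‖ ≤ ‖x‖B + C₀ s₀^{α₀}/c ≤ ε` for `‖x‖ < δ` and `s₀` small, `η = s₀c²`.

References: Seregin–Šverák 2009, §2 p. 8; Lemarié-Rieusset 2016, proof of Thm. 15.4, Step 2; Albritton–Barker
2019, §1 (the quantity `𝐈`); KNSS 2009, §1 (pressure gauge).
-/

noncomputable section

set_option linter.dupNamespace false

namespace Summit.NavierStokesRegularity.NavierStokesRegularity.Theorems.RellichScarApexLocalisation

open MeasureTheory Set Function Metric Filter Topology TopologicalSpace
open scoped ENNReal NNReal InnerProductSpace RealInnerProductSpace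
open Literature.Analysis Literature.Analysis.FluidPDE
open Summit.NavierStokesRegularity.NavierStokesRegularity.Theorems.RellichScarNoMildScar

local notation "E³" => EuclideanSpace ℝ (Fin 3)

/-- The open backward slab `(-∞, 0) × ℝ³` (time first). -/
local notation "𝕊" => Literature.Analysis.FluidPDE.slab (EuclideanSpace ℝ (Fin 3)) (Set.Iio (0 : ℝ)) isOpen_Iio

/-! ### Geometry of nested cones -/

/-- **A ball of proportional radius about a point of the narrow cone lies in the wide cone**: if `‖e‖ = 1`,
`κ < κ'`, `c (1 + |κ|) ≤ (κ' − κ)/2` and `κ'‖x‖ < ⟪x, e⟫`, then every `y` with `‖y − x‖ ≤ c‖x‖` satisfies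
`κ‖y‖ < ⟪y, e⟫`. [folklore] -/
theorem cone_mem_of_norm_sub_le {κ κ' c : ℝ} {e x y : E³} (he : ‖e‖ = 1)
    (hc : c * (1 + |κ|) ≤ (κ' - κ) / 2) (hκ : κ < κ') (hx : κ' * ‖x‖ < ⟪x, e⟫) (hy : ‖y - x‖ ≤ c * ‖x‖) :
    κ * ‖y‖ < ⟪y, e⟫ := by
  have h1 : ⟪y, e⟫ = ⟪x, e⟫ + ⟪y - x, e⟫ := by rw [inner_sub_left]; ring
  have h2 : |⟪y - x, e⟫| ≤ ‖y - x‖ := by simpa [he] using abs_real_inner_le_norm (y - x) e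
  have h3 : |‖y‖ - ‖x‖| ≤ ‖y - x‖ := abs_norm_sub_norm_le y x
  have h4 : κ * (‖y‖ - ‖x‖) ≤ |κ| * ‖y - x‖ := by
    calc κ * (‖y‖ - ‖x‖) ≤ |κ * (‖y‖ - ‖x‖)| := le_abs_self _
      _ = |κ| * |‖y‖ - ‖x‖| := abs_mul _ _
      _ ≤ |κ| * ‖y - x‖ := mul_le_mul_of_nonneg_left h3 (abs_nonneg _)
  have h5 : |κ| * ‖y - x‖ ≤ |κ| * (c * ‖x‖) := mul_le_mul_of_nonneg_left hy (abs_nonneg _)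
  have h6 : c * (1 + |κ|) * ‖x‖ ≤ (κ' - κ) / 2 * ‖x‖ := mul_le_mul_of_nonneg_right hc (norm_nonneg _)
  have h7 := neg_abs_le (⟪y - x, e⟫)
  have h8 : 0 ≤ (κ' - κ) * ‖x‖ := mul_nonneg (sub_nonneg.2 hκ.le) (norm_nonneg _)
  linarith

/-- Points of the ball `B(x, c‖x‖)`, `c < 1`, have norm at least `(1 − c)‖x‖`. [folklore] -/
theorem norm_ge_of_norm_sub_le {c : ℝ} {x y : E³} (hy : ‖y - x‖ ≤ c * ‖x‖) : (1 - c) * ‖x‖ ≤ ‖y‖ := by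
  have h := norm_sub_norm_le x y
  rw [← norm_neg (x - y), neg_sub] at h
  linarith

/-! ### The Navier–Stokes zoom about `(0, x)` by the factor `r` -/

/-- The zoom `(s, y) ↦ (r² s, x + r y)` pulls the parabolic ball `Q((0,x), r)` back to the unit one `Q(0, 1)`.
[folklore] -/
theorem stAffine_preimage_parabolicCylinder_apex {r : ℝ} (hr : 0 < r) (x : E³) :
    stAffine (r ^ 2) r 0 x ⁻¹' parabolicCylinder r ((0 : ℝ), x) = parabolicCylinder 1 (0 : ℝ × E³) := by
  have hr2 : 0 < r ^ 2 := by positivity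
  ext ⟨s, y⟩
  simp only [mem_preimage, stAffine_apply, mem_parabolicCylinder, Prod.fst_zero, Prod.snd_zero, zero_add,
    dist_eq_norm, add_sub_cancel_left, sub_zero, norm_smul, Real.norm_of_nonneg hr.le]
  constructor
  · rintro ⟨⟨h1, h2⟩, h3⟩
    refine ⟨⟨?_, ?_⟩, ?_⟩
    · exact lt_of_mul_lt_mul_left (by linarith : r ^ 2 * (0 - 1 ^ 2) < r ^ 2 * s) hr2.le
    · exact lt_of_mul_lt_mul_left (by linarith : r ^ 2 * s < r ^ 2 * 0) hr2.le
    · exact lt_of_mul_lt_mul_left (by linarith : r * ‖y‖ < r * 1) hr.le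
  · rintro ⟨⟨h1, h2⟩, h3⟩
    have h1' := mul_lt_mul_of_pos_left h1 hr2
    have h3' := mul_lt_mul_of_pos_left h3 hr
    exact ⟨⟨by linarith, mul_neg_of_pos_of_neg hr2 h2⟩, by linarith⟩

/-- The scaling factors of the zoomed gauge pressure cancel: `(r²)^{3/2} · (r² · r³)⁻¹ · r² = 1`. [folklore] -/
theorem zoom_scale_factor {r : ℝ} (hr : 0 < r) :
    ‖(r ^ 2 : ℝ)‖ₑ ^ (3 / 2 : ℝ) * ENNReal.ofReal (r ^ 2 * r ^ 3)⁻¹ * ENNReal.ofReal r ^ 2 = 1 := by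
  have h1 : ‖(r ^ 2 : ℝ)‖ₑ ^ (3 / 2 : ℝ) = ENNReal.ofReal (r ^ 3) := by
    rw [Real.enorm_eq_ofReal (by positivity), ENNReal.ofReal_rpow_of_nonneg (by positivity) (by norm_num)]
    congr 1
    rw [← Real.rpow_natCast r 2, ← Real.rpow_mul hr.le, ← Real.rpow_natCast r 3]
    norm_num
  rw [h1, ← ENNReal.ofReal_pow hr.le, ← ENNReal.ofReal_mul (by positivity),
    ← ENNReal.ofReal_mul (by positivity), ← ENNReal.ofReal_one]
  congr 1
  field_simp

/-- Distances of zeroth derivatives are distances of values (`iteratedFDeriv ℝ 0` is an isometric copy of the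
function). [folklore] -/
theorem dist_iteratedFDeriv_zero (f g : E³ → E³) (a b : E³) :
    dist (iteratedFDeriv ℝ 0 f a) (iteratedFDeriv ℝ 0 g b) = dist (f a) (g b) := by
  rw [dist_eq_norm, dist_eq_norm]
  have : iteratedFDeriv ℝ 0 f a - iteratedFDeriv ℝ 0 g b = iteratedFDeriv ℝ 0 (fun y => f y - g b) a := by
    ext m
    simp [iteratedFDeriv_zero_apply]
  rw [this, norm_iteratedFDeriv_zero]

/-- **Serrin's interior regularity with constants fixed before the solution, zeroth order on `Q(z, 1/2)`**:
for data `(1, M, P)` there is ONE Hölder modulus `(C₀, α₀)`, `α₀ > 0`, such that every distributional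
Navier–Stokes solution on a unit parabolic ball `Q(z, 1)` bounded by `M` a.e. with `∫|π|^{3/2} ≤ P` has a
representative which is `(C₀, α₀)`-Hölder on `Q(z, 1/2)` (`NSBoundedHigherRegularityBounds_holds`, `n = 0`,
`r = 1/2`). [cite: SereginSverak2009, §2 p. 8] -/
theorem exists_uniform_centre_modulus (M : ℝ) (P : ℝ≥0) :
    ∃ C₀ α₀ : ℝ≥0, 0 < α₀ ∧ ∀ (v : ℝ → E³ → E³) (π : ℝ → E³ → ℝ) (z : ℝ × E³),
      IsDistributionalNSSolutionOn (parabolicCylinderOpens 1 z) 1 0 v π →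
      (∀ᵐ w ∂(volume.restrict (parabolicCylinder 1 z)), ‖v w.1 w.2‖ ≤ M) →
      (∫⁻ w in parabolicCylinder 1 z, ‖π w.1 w.2‖ₑ ^ (3 / 2 : ℝ) ≤ P) →
      ∃ V : ℝ → E³ → E³, uncurry v =ᵐ[volume.restrict (parabolicCylinder 1 z)] uncurry V ∧
        HolderOnWith C₀ α₀ (fun w : ℝ × E³ => iteratedFDeriv ℝ 0 (V w.1) w.2) (parabolicCylinder (1 / 2) z) := by
  obtain ⟨_, Cf, αf, hαf, hreg⟩ := NSBoundedHigherRegularityBounds_holds 1 M P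
  have hhalf : (1 / 2 : ℝ) ∈ Ioo 0 1 := ⟨by norm_num, by norm_num⟩
  refine ⟨Cf 0 (1 / 2), αf 0 (1 / 2), hαf 0 _ hhalf, fun v π z h1 h2 h3 => ?_⟩
  obtain ⟨V, hae, -, hH⟩ := hreg v π z h1 h2 h3
  exact ⟨V, hae, (hH 0 (1 / 2) hhalf).1⟩

/-- **The zoom step.**  Let `u` be a continuous suitable weak slab solution with `𝐈 < ⊤`, and let `(C₀, α₀)` be a
uniform zeroth-order Hölder modulus on `Q(·, 1/2)` for the data `(1, M, 𝐈)` (`exists_uniform_centre_modulus`).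
If `r‖u(t', y)‖ ≤ M` for all `t' < 0` and `y ∈ B(x, r)`, then at the centre `x` the velocity has the Hölder
modulus `r‖u(r²s, x) − u(r²s', x)‖ ≤ C₀|s − s'|^{α₀}` for `s, s' ∈ ]−1/4, 0[`: the zoom
`v(s,y) = r u(r²s, x + ry)` solves the equations on `Q(0,1)` with the cylinder-gauged pressure
`r²(p − [p]_{B(x,r)})`, `|v| ≤ M`, `∫_{Q(0,1)}|π_v|^{3/2} = r⁻²∫_{Q((0,x),r)}|p − [p]|^{3/2} ≤ 𝐈`, and the
Hölder representative coincides with the continuous `v` on `Q(0, 1/2)`.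
[cite: SereginSverak2009, §2 p. 8] [cite: AlbrittonBarker2019, §1] -/
theorem centre_modulus_of_zoom {u : ℝ → E³ → E³} {p : ℝ → E³ → ℝ} {G : ℝ → E³ → E³ →L[ℝ] E³}
    (hsw : IsSuitableWeakSolutionOn 𝕊 1 0 u p) (hI : typeIBound (Iio (0 : ℝ) ×ˢ (univ : Set E³)) u p G < ⊤)
    (hcont : ContinuousOn (uncurry u) (Iio (0 : ℝ) ×ˢ (univ : Set E³))) {M : ℝ} {C₀ α₀ : ℝ≥0} (hα₀ : 0 < α₀)
    (hreg : ∀ (v : ℝ → E³ → E³) (π : ℝ → E³ → ℝ) (z : ℝ × E³),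
      IsDistributionalNSSolutionOn (parabolicCylinderOpens 1 z) 1 0 v π →
      (∀ᵐ w ∂(volume.restrict (parabolicCylinder 1 z)), ‖v w.1 w.2‖ ≤ M) →
      (∫⁻ w in parabolicCylinder 1 z, ‖π w.1 w.2‖ₑ ^ (3 / 2 : ℝ) ≤
        (typeIBound (Iio (0 : ℝ) ×ˢ (univ : Set E³)) u p G).toNNReal) →
      ∃ V : ℝ → E³ → E³, uncurry v =ᵐ[volume.restrict (parabolicCylinder 1 z)] uncurry V ∧
        HolderOnWith C₀ α₀ (fun w : ℝ × E³ => iteratedFDeriv ℝ 0 (V w.1) w.2) (parabolicCylinder (1 / 2) z))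
    {x : E³} {r : ℝ} (hr : 0 < r) (hM : ∀ t' : ℝ, t' < 0 → ∀ y : E³, ‖y - x‖ < r → r * ‖u t' y‖ ≤ M) :
    ∀ s s' : ℝ, -(1 / 4) < s → s < 0 → -(1 / 4) < s' → s' < 0 →
      ‖r • u (r ^ 2 * s) x - r • u (r ^ 2 * s') x‖ ≤ C₀ * |s - s'| ^ (α₀ : ℝ) := by
  have hr2 : 0 < r ^ 2 := by positivity
  set I : ℝ≥0∞ := typeIBound (Iio (0 : ℝ) ×ˢ (univ : Set E³)) u p G with hIdef
  have hPeq : ((I.toNNReal : ℝ≥0) : ℝ≥0∞) = I := ENNReal.coe_toNNReal hI.ne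
  -- ## the equations on `Q((0,x), r)` in the cylinder gauge
  have hz : ((0 : ℝ), x).1 ≤ 0 := le_rfl
  have hsolQ : IsDistributionalNSSolutionOn (parabolicCylinderOpens r ((0 : ℝ), x)) 1 0 u
      (fun t y => p t y - ⨍ y' in ball x r, p t y') :=
    ((sub_ballMean_slab hsw x hr).of_le (parabolicCylinderOpens_le_slab r hz)).distributional
  have hPQ : ∫⁻ w in parabolicCylinder r ((0 : ℝ), x), ‖p w.1 w.2 - ⨍ y' in ball x r, p w.1 y'‖ₑ ^ (3 / 2 : ℝ) ≤
      ENNReal.ofReal r ^ 2 * I :=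
    lintegral_sub_ballMean_le_typeIBound hr hz u p G
  -- ## the zoomed pair on `Q(0, 1)`
  have hpre : stPreimage (r ^ 2) r 0 x (parabolicCylinderOpens r ((0 : ℝ), x)) =
      parabolicCylinderOpens 1 (0 : ℝ × E³) := by
    ext1
    rw [coe_stPreimage, coe_parabolicCylinderOpens, coe_parabolicCylinderOpens,
      stAffine_preimage_parabolicCylinder_apex hr x]
  have hsolv : IsDistributionalNSSolutionOn (parabolicCylinderOpens 1 (0 : ℝ × E³)) 1 0
      (r • stPull (r ^ 2) r 0 x u) (r ^ 2 • stPull (r ^ 2) r 0 x (fun t y => p t y - ⨍ y' in ball x r, p t y')) := by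
    have h := hsolQ.stRescale hr hr (show r ^ 2 = r * r by ring) 0 x
    rw [hpre] at h
    have e1 : r * 1 / r = 1 := by rw [mul_one, div_self hr.ne']
    have e2 : ((r ^ 2 * r) • stPull (r ^ 2) r 0 x (0 : ℝ → E³ → E³)) = 0 := by
      funext s y; simp [stPull]
    rw [e1, e2] at h
    exact h
  -- the sup bound `M`
  have hbdv : ∀ᵐ w ∂(volume.restrict (parabolicCylinder 1 (0 : ℝ × E³))),
      ‖(r • stPull (r ^ 2) r 0 x u) w.1 w.2‖ ≤ M := by
    refine ae_restrict_of_forall_mem (isOpen_parabolicCylinder _ _).measurableSet fun w hw => ?_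
    simp only [mem_parabolicCylinder, Prod.fst_zero, Prod.snd_zero, dist_zero_right] at hw
    obtain ⟨⟨-, hw2⟩, hw3⟩ := hw
    have ht' : 0 + r ^ 2 * w.1 < 0 := by rw [zero_add]; exact mul_neg_of_pos_of_neg hr2 hw2
    have hy : ‖(x + r • w.2) - x‖ < r := by
      rw [add_sub_cancel_left, norm_smul, Real.norm_of_nonneg hr.le]
      calc r * ‖w.2‖ < r * 1 := mul_lt_mul_of_pos_left hw3 hr
        _ = r := mul_one r
    have h := hM _ ht' _ hy
    rw [smul_stPull_apply, norm_smul, Real.norm_of_nonneg hr.le]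
    exact h
  -- the pressure bound `𝐈`
  have hPv : ∫⁻ w in parabolicCylinder 1 (0 : ℝ × E³),
      ‖(r ^ 2 • stPull (r ^ 2) r 0 x (fun t y => p t y - ⨍ y' in ball x r, p t y')) w.1 w.2‖ₑ ^ (3 / 2 : ℝ) ≤
        I.toNNReal := by
    rw [hPeq, ← stAffine_preimage_parabolicCylinder_apex hr x,
      setLIntegral_enorm_rpow_stRescale hr2 hr 0 x (r ^ 2) _ _ (by norm_num : (0 : ℝ) ≤ 3 / 2),
      finrank_euclideanSpace_fin]
    calc ‖(r ^ 2 : ℝ)‖ₑ ^ (3 / 2 : ℝ) * ENNReal.ofReal (r ^ 2 * r ^ 3)⁻¹ *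
          ∫⁻ w in parabolicCylinder r ((0 : ℝ), x), ‖p w.1 w.2 - ⨍ y' in ball x r, p w.1 y'‖ₑ ^ (3 / 2 : ℝ)
        ≤ ‖(r ^ 2 : ℝ)‖ₑ ^ (3 / 2 : ℝ) * ENNReal.ofReal (r ^ 2 * r ^ 3)⁻¹ * (ENNReal.ofReal r ^ 2 * I) :=
          mul_le_mul_right hPQ _
      _ = I := by rw [← mul_assoc, zoom_scale_factor hr, one_mul]
  -- ## the Hölder representative is the zoomed field on `Q(0, 1/2)`
  obtain ⟨V, hae, hHol⟩ := hreg _ _ (0 : ℝ × E³) hsolv hbdv hPv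
  have hsub : parabolicCylinder (1 / 2) (0 : ℝ × E³) ⊆ parabolicCylinder 1 (0 : ℝ × E³) := by
    intro w hw
    simp only [mem_parabolicCylinder, Prod.fst_zero, Prod.snd_zero] at hw ⊢
    exact ⟨⟨by linarith [hw.1.1], hw.1.2⟩, hw.2.trans (by norm_num)⟩
  have hmaps : MapsTo (stAffine (r ^ 2) r 0 x) (parabolicCylinder (1 / 2) (0 : ℝ × E³))
      (Iio (0 : ℝ) ×ˢ (univ : Set E³)) := by
    intro w hw
    simp only [mem_parabolicCylinder, Prod.fst_zero, Prod.snd_zero] at hw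
    refine ⟨?_, mem_univ _⟩
    show 0 + r ^ 2 * w.1 < 0
    rw [zero_add]
    exact mul_neg_of_pos_of_neg hr2 hw.1.2
  have hvc : ContinuousOn (uncurry (r • stPull (r ^ 2) r 0 x u)) (parabolicCylinder (1 / 2) (0 : ℝ × E³)) := by
    have h1 : ContinuousOn (uncurry u ∘ stAffine (r ^ 2) r 0 x) (parabolicCylinder (1 / 2) (0 : ℝ × E³)) :=
      hcont.comp (continuous_stAffine _ _ _ _).continuousOn hmaps
    have h2 : uncurry (r • stPull (r ^ 2) r 0 x u) = fun z => r • (uncurry u ∘ stAffine (r ^ 2) r 0 x) z := by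
      funext z; rfl
    rw [h2]
    exact h1.const_smul r
  have hVc : ContinuousOn (uncurry V) (parabolicCylinder (1 / 2) (0 : ℝ × E³)) :=
    continuousOn_uncurry_of_holderOnWith_zero hα₀ hHol
  have heqOn : EqOn (uncurry (r • stPull (r ^ 2) r 0 x u)) (uncurry V) (parabolicCylinder (1 / 2) (0 : ℝ × E³)) :=
    Measure.eqOn_open_of_ae_eq (ae_restrict_of_ae_restrict_of_subset hsub hae) (isOpen_parabolicCylinder _ _)
      hvc hVc
  -- ## the modulus at the centre
  intro s s' hs1 hs2 hs1' hs2'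
  have hmem : ∀ σ : ℝ, -(1 / 4) < σ → σ < 0 → ((σ, (0 : E³)) : ℝ × E³) ∈ parabolicCylinder (1 / 2) (0 : ℝ × E³) := by
    intro σ h1 h2
    simp only [mem_parabolicCylinder, Prod.fst_zero, Prod.snd_zero, dist_self]
    exact ⟨⟨by linarith, h2⟩, by norm_num⟩
  have h := hHol.dist_le (hmem s hs1 hs2) (hmem s' hs1' hs2')
  dsimp only at h
  rw [dist_iteratedFDeriv_zero, Prod.dist_eq, dist_self, max_eq_left dist_nonneg, Real.dist_eq,
    dist_eq_norm] at h
  have e1 := heqOn (hmem s hs1 hs2)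
  have e2 := heqOn (hmem s' hs1' hs2')
  simp only [uncurry, smul_stPull_apply, zero_add, smul_zero, add_zero] at e1 e2
  rw [← e1, ← e2] at h
  exact h

/-! ### S_B -/

/-- **S_B (stub_faintOfCalmBoundedTrace).** Let `u` be a continuous suitable weak slab solution with a weak gradient,
`𝐈 < ⊤` and the Type-I rate, apex-CALM on the cone `Γ_κ(e) = {κ‖x‖ < ⟪x,e⟫}` (`‖u(t,x)‖ ≤ K/(‖x‖ + √(−t))`) and
with bounded final trace there near the origin (`‖u(t,x)‖ ≤ B` for `t ↑ 0`, `x ∈ Γ_κ`, `‖x‖ < δ₀`).  Then `u` is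
scar-FAINT on every narrower cone `Γ_κ'`, `κ < κ'`.  Proof: for `x ∈ Γ_κ'` the parabolic ball `Q((0,x), c‖x‖)`,
`c = c(κ,κ') ∈ ]0,1/2]`, lies in `]−∞,0[ × Γ_κ`, where calmness gives `c‖x‖‖u‖ ≤ |K|`; after the NS rescaling by
`c‖x‖` Serrin's interior regularity (`NSBoundedHigherRegularityBounds_holds`, pressure gauged cylinder-wise,
`∫|p − [p]|^{3/2} ≤ r²𝐈`) gives a Hölder modulus in time UNIFORM in `x` (`centre_modulus_of_zoom`), so
`c‖x‖‖u(t,x) − u(τ,x)‖ ≤ C₀ s₀^{α₀}` for `−s₀c²‖x‖² < t, τ < 0`, while `‖u(τ,x)‖ ≤ B` for suitable `τ` (the trace);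
hence `‖x‖‖u(t,x)‖ ≤ ‖x‖B + C₀s₀^{α₀}/c ≤ ε` for `‖x‖ < δ`, `s₀` small.
[cite: SereginSverak2009, §2 p. 8] [cite: LemarieRieusset2016, proof of Thm. 15.4, Step 2] -/
theorem stub_faintOfCalmBoundedTrace :
    ∀ (κ κ' : ℝ), κ < κ' → ∀ (C K B δ₀ : ℝ) (e : EuclideanSpace ℝ (Fin 3)), ‖e‖ = 1 → 0 < δ₀ →
      ∀ (u : ℝ → EuclideanSpace ℝ (Fin 3) → EuclideanSpace ℝ (Fin 3)) (p : ℝ → EuclideanSpace ℝ (Fin 3) → ℝ)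
        (G : ℝ → EuclideanSpace ℝ (Fin 3) → EuclideanSpace ℝ (Fin 3) →L[ℝ] EuclideanSpace ℝ (Fin 3)),
      Literature.Analysis.FluidPDE.IsSuitableWeakSolutionOn
          (Literature.Analysis.FluidPDE.slab (EuclideanSpace ℝ (Fin 3)) (Set.Iio (0 : ℝ)) isOpen_Iio) 1 0 u p →
      Literature.Analysis.FluidPDE.HasWeakSpatialGradientOn
          (Literature.Analysis.FluidPDE.slab (EuclideanSpace ℝ (Fin 3)) (Set.Iio (0 : ℝ)) isOpen_Iio) u G →
      Literature.Analysis.FluidPDE.typeIBound (Set.Iio (0 : ℝ) ×ˢ Set.univ) u p G < ⊤ →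
      Literature.Analysis.FluidPDE.HasTypeITimeDecay C u →
      ContinuousOn (Function.uncurry u) (Set.Iio (0 : ℝ) ×ˢ Set.univ) →
      (∀ t : ℝ, t < 0 → ∀ x : EuclideanSpace ℝ (Fin 3), κ * ‖x‖ < inner ℝ x e →
        ‖u t x‖ ≤ K / (‖x‖ + Real.sqrt (-t))) →
      (∀ x : EuclideanSpace ℝ (Fin 3), κ * ‖x‖ < inner ℝ x e → ‖x‖ < δ₀ →
        ∀ᶠ t in nhdsWithin (0 : ℝ) (Set.Iio 0), ‖u t x‖ ≤ B) →
      ∀ ε : ℝ, 0 < ε → ∃ δ : ℝ, 0 < δ ∧ ∃ η : ℝ, 0 < η ∧ ∀ x : EuclideanSpace ℝ (Fin 3),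
        κ' * ‖x‖ < inner ℝ x e → ‖x‖ < δ → ∀ t : ℝ, -η * ‖x‖ ^ 2 < t → t < 0 → ‖x‖ * ‖u t x‖ ≤ ε := by
  intro κ κ' hκ C K B δ₀ e he hδ₀ u p G hsw _hwg hI _hrate hcont hcalm htrace ε hε
  -- ## constants: the aperture ratio `c`, the uniform modulus `(C₀, α₀)`, the window `s₀`
  obtain ⟨c, hc0, hc1, hcκ⟩ : ∃ c : ℝ, 0 < c ∧ c ≤ 1 / 2 ∧ c * (1 + |κ|) ≤ (κ' - κ) / 2 := by
    have hκpos : 0 < κ' - κ := sub_pos.2 hκ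
    have habs : 0 < 1 + |κ| := by positivity
    refine ⟨min (1 / 2) ((κ' - κ) / (2 * (1 + |κ|))), lt_min (by norm_num) (by positivity), min_le_left _ _, ?_⟩
    have h1 : min (1 / 2) ((κ' - κ) / (2 * (1 + |κ|))) ≤ (κ' - κ) / (2 * (1 + |κ|)) := min_le_right _ _
    calc min (1 / 2) ((κ' - κ) / (2 * (1 + |κ|))) * (1 + |κ|) ≤ (κ' - κ) / (2 * (1 + |κ|)) * (1 + |κ|) :=
          mul_le_mul_of_nonneg_right h1 habs.le
      _ = (κ' - κ) / 2 := by field_simp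
  obtain ⟨C₀, α₀, hα₀, hreg⟩ :=
    exists_uniform_centre_modulus |K| (typeIBound (Iio (0 : ℝ) ×ˢ (univ : Set E³)) u p G).toNNReal
  have hα₀' : (0 : ℝ) < α₀ := NNReal.coe_pos.2 hα₀
  have hC₀ : (0 : ℝ) ≤ C₀ := C₀.coe_nonneg
  obtain ⟨s₀, hs₀0, hs₀1, hs₀A⟩ : ∃ s₀ : ℝ, 0 < s₀ ∧ s₀ ≤ 1 / 4 ∧ (C₀ : ℝ) * s₀ ^ (α₀ : ℝ) ≤ c * ε / 2 := by
    set A : ℝ := c * ε / (2 * (C₀ + 1)) with hA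
    have hA0 : 0 < A := by positivity
    refine ⟨min (1 / 4) (A ^ (α₀ : ℝ)⁻¹), lt_min (by norm_num) (Real.rpow_pos_of_pos hA0 _), min_le_left _ _, ?_⟩
    have h1 : (min (1 / 4) (A ^ (α₀ : ℝ)⁻¹)) ^ (α₀ : ℝ) ≤ A := by
      calc (min (1 / 4) (A ^ (α₀ : ℝ)⁻¹)) ^ (α₀ : ℝ) ≤ (A ^ (α₀ : ℝ)⁻¹) ^ (α₀ : ℝ) :=
            Real.rpow_le_rpow (le_min (by norm_num) (Real.rpow_nonneg hA0.le _)) (min_le_right _ _) hα₀'.le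
        _ = A := Real.rpow_inv_rpow hA0.le hα₀'.ne'
    have h2 : (C₀ : ℝ) * A ≤ c * ε / 2 := by
      rw [hA, mul_div_assoc', div_le_div_iff₀ (by positivity) (by positivity)]
      nlinarith [mul_pos hc0 hε]
    exact (mul_le_mul_of_nonneg_left h1 hC₀).trans h2
  -- ## the answer: `δ = min δ₀ (ε / (2(|B|+1)))`, `η = s₀ c²`
  refine ⟨min δ₀ (ε / (2 * (|B| + 1))), lt_min hδ₀ (by positivity), s₀ * c ^ 2, by positivity, ?_⟩
  intro x hxΓ hxδ t ht1 ht2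
  -- the point and the scale `r = c‖x‖`
  have hx0 : 0 < ‖x‖ := by
    rcases (norm_nonneg x).eq_or_lt with h | h
    · exfalso
      have hx' : x = 0 := norm_eq_zero.1 h.symm
      rw [hx', norm_zero, mul_zero, inner_zero_left] at hxΓ
      exact lt_irrefl _ hxΓ
    · exact h
  have hxΓκ : κ * ‖x‖ < ⟪x, e⟫ := lt_trans (mul_lt_mul_of_pos_right hκ hx0) hxΓ
  have hxδ₀ : ‖x‖ < δ₀ := lt_of_lt_of_le hxδ (min_le_left _ _)
  have hxε : ‖x‖ * |B| ≤ ε / 2 := by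
    have h1 : ‖x‖ ≤ ε / (2 * (|B| + 1)) := (lt_of_lt_of_le hxδ (min_le_right _ _)).le
    have h2 : ‖x‖ * |B| ≤ ε / (2 * (|B| + 1)) * |B| := mul_le_mul_of_nonneg_right h1 (abs_nonneg B)
    have h3 : ε / (2 * (|B| + 1)) * |B| ≤ ε / 2 := by
      rw [div_mul_eq_mul_div, div_le_div_iff₀ (by positivity) (by positivity)]
      nlinarith [abs_nonneg B]
    linarith
  obtain ⟨r, hr_def⟩ : ∃ r : ℝ, r = c * ‖x‖ := ⟨_, rfl⟩
  have hr : 0 < r := by rw [hr_def]; positivity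
  have hr2 : 0 < r ^ 2 := by positivity
  -- ## calmness bounds `r|u|` by `|K|` on `]−∞,0[ × B(x, r)`
  have hM : ∀ t' : ℝ, t' < 0 → ∀ y : E³, ‖y - x‖ < r → r * ‖u t' y‖ ≤ |K| := by
    intro t' ht' y hy
    rw [hr_def] at hy
    have hyΓ : κ * ‖y‖ < ⟪y, e⟫ := cone_mem_of_norm_sub_le he hcκ hκ hxΓ hy.le
    have hy1 : (1 - c) * ‖x‖ ≤ ‖y‖ := norm_ge_of_norm_sub_le hy.le
    have hypos : 0 < (1 - c) * ‖x‖ := mul_pos (by linarith) hx0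
    have hden : 0 < ‖y‖ + Real.sqrt (-t') := add_pos_of_pos_of_nonneg (hypos.trans_le hy1) (Real.sqrt_nonneg _)
    calc r * ‖u t' y‖ ≤ r * (K / (‖y‖ + Real.sqrt (-t'))) := mul_le_mul_of_nonneg_left (hcalm t' ht' y hyΓ) hr.le
      _ ≤ r * (|K| / ((1 - c) * ‖x‖)) := by
          refine mul_le_mul_of_nonneg_left ?_ hr.le
          calc K / (‖y‖ + Real.sqrt (-t')) ≤ |K| / (‖y‖ + Real.sqrt (-t')) :=
                div_le_div_of_nonneg_right (le_abs_self K) hden.le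
            _ ≤ |K| / ((1 - c) * ‖x‖) :=
                div_le_div_of_nonneg_left (abs_nonneg K) hypos (by linarith [Real.sqrt_nonneg (-t')])
      _ = c / (1 - c) * |K| := by rw [hr_def]; field_simp
      _ ≤ 1 * |K| := by
          refine mul_le_mul_of_nonneg_right ?_ (abs_nonneg K)
          rw [div_le_one (by linarith)]
          linarith
      _ = |K| := one_mul _
  -- ## the uniform modulus at the centre `x` (Serrin after the zoom)
  have hmod := centre_modulus_of_zoom hsw hI hcont hα₀ hreg hr hM
  -- ## zoomed times: `s = t/r² ∈ ]−s₀, 0[` and a later `τ` carrying the trace bound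
  obtain ⟨τ, hτB, hτt, hτ0⟩ := ((htrace x hxΓκ hxδ₀).and (Ioo_mem_nhdsLT ht2)).exists
  have hst : -s₀ < t / r ^ 2 := by
    rw [lt_div_iff₀ hr2]
    have h1 : -(s₀ * c ^ 2) * ‖x‖ ^ 2 = -s₀ * r ^ 2 := by rw [hr_def]; ring
    linarith
  have hs0 : t / r ^ 2 < 0 := div_neg_of_neg_of_pos ht2 hr2
  have hss' : t / r ^ 2 < τ / r ^ 2 := div_lt_div_of_pos_right hτt hr2
  have hs'0 : τ / r ^ 2 < 0 := div_neg_of_neg_of_pos hτ0 hr2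
  have h := hmod (t / r ^ 2) (τ / r ^ 2) (by linarith) hs0 (by linarith) hs'0
  rw [mul_div_cancel₀ t hr2.ne', mul_div_cancel₀ τ hr2.ne'] at h
  have habs : |t / r ^ 2 - τ / r ^ 2| ≤ s₀ := by
    rw [abs_sub_comm, abs_of_pos (sub_pos.2 hss')]
    linarith
  have hdiff : ‖r • u t x - r • u τ x‖ ≤ C₀ * s₀ ^ (α₀ : ℝ) :=
    h.trans (mul_le_mul_of_nonneg_left (Real.rpow_le_rpow (abs_nonneg _) habs hα₀'.le) hC₀)
  -- ## the estimate
  have hkey : r * ‖u t x‖ ≤ r * B + C₀ * s₀ ^ (α₀ : ℝ) := by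
    have e1 : ‖r • u t x‖ = r * ‖u t x‖ := by rw [norm_smul, Real.norm_of_nonneg hr.le]
    have e2 : ‖r • u τ x‖ = r * ‖u τ x‖ := by rw [norm_smul, Real.norm_of_nonneg hr.le]
    have h1 := norm_sub_norm_le (r • u t x) (r • u τ x)
    have h2 : r * ‖u τ x‖ ≤ r * B := mul_le_mul_of_nonneg_left hτB hr.le
    linarith
  calc ‖x‖ * ‖u t x‖ = c⁻¹ * (r * ‖u t x‖) := by rw [hr_def]; field_simp
    _ ≤ c⁻¹ * (r * B + C₀ * s₀ ^ (α₀ : ℝ)) := mul_le_mul_of_nonneg_left hkey (inv_nonneg.2 hc0.le)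
    _ = ‖x‖ * B + c⁻¹ * (C₀ * s₀ ^ (α₀ : ℝ)) := by rw [hr_def]; field_simp
    _ ≤ ‖x‖ * |B| + c⁻¹ * (c * ε / 2) :=
        add_le_add (mul_le_mul_of_nonneg_left (le_abs_self B) (norm_nonneg _))
          (mul_le_mul_of_nonneg_left hs₀A (inv_nonneg.2 hc0.le))
    _ = ‖x‖ * |B| + ε / 2 := by congr 1; field_simp
    _ ≤ ε := by linarith

end Summit.NavierStokesRegularity.NavierStokesRegularity.Theorems.RellichScarApexLocalisation

end
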